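import Summits.QuantumFields.BalabanUV.T4Continuum.Spine.NE2.OneStepRemainderLoopCoeff
import Summits.QuantumFields.BalabanUV.T4Continuum.Spine.NE2.OneStepRemainderCoefficientsLipschitz

/-!
# T⁴ programme, spine node NE2 (U1a) — R14 W3c″, file 2: THE LOOP LOGARITHMS AND (124)'s COEFFICIENT DATA ARE LIPSCHITZ IN THE BACKGROUND — the cross-problem letters `δG`
# from NE3-type closeness of the FUNDAMENTAL fields (cell `pub-balaban-gaps`, seat ne2 gen 6)

The END `ComposedRemainderTwoLevel.composed_full_averaging_rate_of_letters` displays, per problem pair `(k+1, k)` and step `i`, the letter `δG k i` bounding the difference of (124)'s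
coefficient operators built from the two backgrounds (`hGd₁/hGd₂/hGd₃`).  With the coefficients SUPPLIED as functions of the background (`OneStepRemainderLoopCoeff.remCoeffOf`:
`G₁ = g(−i ad_Y)g⁻¹(−i ad_{Y_x}) − 1` etc. of the loop logarithms `Y_x = (1/i) log U(Γ_{c,x} ∪ (−c))`, `Y = Σ_x L^{−d} Y_x`), that letter follows from a LIPSCHITZ chain, which THIS FILE
assembles on the tree's one-step carriers:
 * §1 transports and the loop of (114) are Lipschitz in the bond data for contractive/unitary fields (**`norm_transport_sub_le_length`** `≤ |Γ|·δ`, **`norm_loopHol_sub_loopHol_le`**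
   `≤ 2(Σ_ν r_ν + L)·δ`), hence — by the logarithm's Lipschitz bound near `1` (`OneStepRemainderCoefficientsLipschitz.norm_mlog_sub_mlog_le`, (21)/(26)) — so are the loop logarithms:
   **`norm_Yx_sub_Yx_le`**, **`norm_Ybar_sub_Ybar_le`** (`≤ 4(Σ_ν r_ν + L)·δ` once both loops are within `1/2` of `1`);
 * §2 `adLie` is real-linear (**`adLie_sub`**), so `‖ad_Y − ad_{Y′}‖ ≤ 2‖Y − Y′‖` (**`norm_cpx_adLie_sub_le`**), and the three coefficient shapes are Lipschitz in `(Y, Y_x)` on the ball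
   `‖·‖ ≤ y ≤ 1/8` of the frame's carrier `P`: **`norm_coeffG₁_sub_le`** / `G₂` / `G₃` (`≤ 48·η` for arguments within `η`);
 * §3 along the tower: **`norm_remCoeffOf_G₁_sub_le`** / `G₂` / `G₃` — for two unitary fundamental towers `U`, `U′` whose level-`(i+1)` fields are within `cU` bondwise, with plaquette
   letters `p` (`d·L²·p ≤ 1/16`) and the `Y_x` in `P`, the coefficient data at step `i` differ by at most `192·(d+1)·L·cU` — the `δG k i` letter in NE3-type currency (closeness of the
   data of the problems at levels `k+1` and `k`, here the fundamental fields; print has no such statement — NE3's business, consumed as a letter).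
HONEST FRAMING (T4-DAG p. 1).  [folklore] bookkeeping about MODEL objects; `U`, `U′`, `W`, the frame are DATA asserted by nobody; nothing of Bałaban's asserted; NOT an instance of Bałaban's
minimiser or of (3.35); NOT NE2/NE3; **NE2 (U1a) NOT PROVED**; spine PROVED 0/9 unchanged; NOT continuum YM / infinite volume / mass gap / Clay.  HONEST DEPENDENCY: continuum YM on T⁴ ⇐
BetaPertH ∧ nine spine estimates (0/9 proved); BetaPertH ⇐ (D1) ∧ (D4) ∧ CAP+tail; G-an2-4 gates asym, D1 and NE2/3/4.  No `sorry`.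
-/

noncomputable section

open scoped BigOperators ComplexConjugate Matrix Matrix.Norms.L2Operator

namespace Summit.QuantumFields.BalabanUV.T4Continuum.NE2.OneStepRemainderLoopLipschitz

open Literature.MathematicalPhysics.QuantumFieldTheory.Balaban1983to89.B5Prop11Plancherel (Tor fine unitVec)
open Literature.MathematicalPhysics.QuantumFieldTheory.Balaban1983to89.B5Block118 (tstep)
open Literature.MathematicalPhysics.QuantumFieldTheory.Balaban1983to89.B5G183RateUnitTower (lev lev_neZero)
open Literature.MathematicalPhysics.QuantumFieldTheory.Balaban1983to89.B5G183RateTorus (cpt)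
open Literature.MathematicalPhysics.QuantumFieldTheory.Balaban1983to89.B9AdOrthogonal (form)
open Literature.MathematicalPhysics.QuantumFieldTheory.Balaban1983to89.MatrixLog (mlog)
open Summit.QuantumFields.BalabanUV.Beta.ThinLoopHolonomy (cpxHom)
open Summit.QuantumFields.BalabanUV.T4Continuum.BalabanAveragedTowerUnit (idx)
open Summit.QuantumFields.BalabanUV.T4Continuum.CovariantBlockAveraging (transport transport_append leg length_leg)
open Summit.QuantumFields.BalabanUV.T4Continuum.NE2.CovariantTableBalaban (contourFrom length_contourFrom)
open Summit.QuantumFields.BalabanUV.T4Continuum.NE2.OneStepLoopLadder (transport_nil)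
open Summit.QuantumFields.BalabanUV.T4Continuum.NE2.OneStepLoopHolonomy (loopHol Yx Ybar norm_le_one_of_unitary transport_mem_unitaryGroup norm_loopHol_sub_one_le_of_digits)
open Summit.QuantumFields.BalabanUV.T4Continuum.NE2.OneStepRemainderAdjoint (adLie adLie_apply norm_cpx_adLie_le coeffG₁ coeffG₂ coeffG₃)
open Summit.QuantumFields.BalabanUV.T4Continuum.NE2.OneStepRemainderCoefficients (gFun)
open Summit.QuantumFields.BalabanUV.T4Continuum.NE2.OneStepRemainderCoefficientsLipschitz (norm_mlog_sub_mlog_le norm_coeff₁_sub_le norm_coeff₂_sub_le norm_coeff₃_sub_le)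
open Summit.QuantumFields.BalabanUV.T4Continuum.NE2.OneStepRemainderLoopCoeff (YxT YbarT remCoeffOf Yx_letters Ybar_letters sum_blockWeight)

variable {d : ℕ}

/-! ## §1 Transports, the loop, and the loop logarithms are Lipschitz in the bond data -/

section Data

variable (N : ℕ) [NeZero N] (M : Fin d → ℕ) [hM : ∀ μ, NeZero (M μ)] {m : Type*} [Fintype m] [DecidableEq m]
  {V V' : Fin d → (Tor (fine N M) × Fin d → Matrix m m ℂ)} (μ : Fin d)

omit [NeZero N] hM in
/-- transport along `b :: P` is the bond variable times the rest. [folklore] -/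
theorem transport_cons (V : Fin d → (Tor (fine N M) × Fin d → Matrix m m ℂ)) (b : Tor (fine N M) × Fin d) (P : List (Tor (fine N M) × Fin d)) :
    transport (fine N M) V μ (b :: P) = V b.2 (b.1, μ) * transport (fine N M) V μ P := by
  simp [transport]

omit [NeZero N] hM in
/-- **TRANSPORTS ARE LIPSCHITZ IN THE DATA**: contractive `V, V′` within `δ` bondwise give `‖T_V(Γ) − T_{V′}(Γ)‖ ≤ |Γ|·δ`. [folklore] -/
theorem norm_transport_sub_le_length [Nonempty m] (hV : ∀ ν b, ‖V ν b‖ ≤ 1) (hV' : ∀ ν b, ‖V' ν b‖ ≤ 1) {δ : ℝ} (hδ : ∀ ν b, ‖V ν b - V' ν b‖ ≤ δ) :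
    ∀ P : List (Tor (fine N M) × Fin d), ‖transport (fine N M) V μ P - transport (fine N M) V' μ P‖ ≤ P.length * δ
  | [] => by rw [transport_nil, transport_nil, sub_self, norm_zero, List.length_nil, Nat.cast_zero, zero_mul]
  | b :: P => by
    have ih := norm_transport_sub_le_length hV hV' hδ P
    have hδ0 : 0 ≤ δ := (norm_nonneg _).trans (hδ b.2 (b.1, μ))
    rw [transport_cons, transport_cons, List.length_cons]
    set T := transport (fine N M) V μ P
    set T' := transport (fine N M) V' μ P
    have e : V b.2 (b.1, μ) * T - V' b.2 (b.1, μ) * T' = (V b.2 (b.1, μ) - V' b.2 (b.1, μ)) * T + V' b.2 (b.1, μ) * (T - T') := by noncomm_ring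
    rw [e]
    have hT : ‖T‖ ≤ 1 := CovariantVectorChartModulus.norm_transport_le_one (fine N M) hV μ P
    have h1 : ‖(V b.2 (b.1, μ) - V' b.2 (b.1, μ)) * T‖ ≤ δ := by
      refine (Matrix.l2_opNorm_mul _ _).trans ?_
      calc _ ≤ δ * 1 := mul_le_mul (hδ _ _) hT (norm_nonneg _) hδ0
        _ = δ := mul_one _
    have h2 : ‖V' b.2 (b.1, μ) * (T - T')‖ ≤ P.length * δ := by
      refine (Matrix.l2_opNorm_mul _ _).trans ?_
      calc _ ≤ 1 * (P.length * δ) := mul_le_mul (hV' _ _) ih (norm_nonneg _) zero_le_one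
        _ = P.length * δ := one_mul _
    refine (norm_add_le _ _).trans ?_
    push_cast
    linarith

omit hM in
/-- **THE LOOP IS LIPSCHITZ IN THE DATA**: for unitary `V, V′` within `δ` bondwise, `‖loopHol_V − loopHol_{V′}‖ ≤ 2(Σ_ν r_ν + ℓ)·δ` (`ABᴴ − A′B′ᴴ = (A − A′)Bᴴ + A′(B − B′)ᴴ`, both paths of
length `Σ_ν r_ν + ℓ`). [folklore] -/
theorem norm_loopHol_sub_loopHol_le [Nonempty m] (hVu : ∀ ν b, V ν b ∈ Matrix.unitaryGroup m ℂ) (hVu' : ∀ ν b, V' ν b ∈ Matrix.unitaryGroup m ℂ) {δ : ℝ}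
    (hδ : ∀ ν b, ‖V ν b - V' ν b‖ ≤ δ) (ℓ : ℕ) (z : Tor (fine N M)) (r : Fin d → ℕ) :
    ‖loopHol N M V μ ℓ z r - loopHol N M V' μ ℓ z r‖ ≤ 2 * ((∑ ν, (r ν : ℝ)) + ℓ) * δ := by
  have hV := norm_le_one_of_unitary N M hVu
  have hV' := norm_le_one_of_unitary N M hVu'
  have hδ0 : 0 ≤ δ := (norm_nonneg _).trans (hδ μ (z, μ))
  rw [loopHol, loopHol, ← transport_append, ← transport_append]
  set A := transport (fine N M) V μ (contourFrom M N z r μ ℓ)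
  set A' := transport (fine N M) V' μ (contourFrom M N z r μ ℓ)
  set B := transport (fine N M) V μ (leg N M μ z ℓ ++ contourFrom M N (z + tstep (fine N M) μ ℓ) r μ 0)
  set B' := transport (fine N M) V' μ (leg N M μ z ℓ ++ contourFrom M N (z + tstep (fine N M) μ ℓ) r μ 0)
  have hA : ‖A - A'‖ ≤ ((∑ ν, (r ν : ℝ)) + ℓ) * δ := by
    have h := norm_transport_sub_le_length N M μ hV hV' hδ (contourFrom M N z r μ ℓ)
    rw [length_contourFrom] at h
    push_cast at h
    exact h
  have hB : ‖B - B'‖ ≤ ((∑ ν, (r ν : ℝ)) + ℓ) * δ := by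
    have h := norm_transport_sub_le_length N M μ hV hV' hδ (leg N M μ z ℓ ++ contourFrom M N (z + tstep (fine N M) μ ℓ) r μ 0)
    rw [List.length_append, length_leg, length_contourFrom, add_zero] at h
    push_cast at h
    linarith
  have hBn : ‖Bᴴ‖ ≤ 1 := by
    rw [Matrix.l2_opNorm_conjTranspose]; exact CovariantVectorChartModulus.norm_transport_le_one (fine N M) hV μ _
  have hA'n : ‖A'‖ ≤ 1 := CovariantVectorChartModulus.norm_transport_le_one (fine N M) hV' μ _
  have e : A * Bᴴ - A' * B'ᴴ = (A - A') * Bᴴ + A' * (B - B')ᴴ := by rw [Matrix.conjTranspose_sub]; noncomm_ring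
  rw [e]
  refine (norm_add_le _ _).trans ?_
  have h1 : ‖(A - A') * Bᴴ‖ ≤ ((∑ ν, (r ν : ℝ)) + ℓ) * δ :=
    (Matrix.l2_opNorm_mul _ _).trans (by nlinarith [norm_nonneg (A - A'), norm_nonneg Bᴴ])
  have h2 : ‖A' * (B - B')ᴴ‖ ≤ ((∑ ν, (r ν : ℝ)) + ℓ) * δ := by
    refine (Matrix.l2_opNorm_mul _ _).trans ?_
    rw [Matrix.l2_opNorm_conjTranspose]
    nlinarith [norm_nonneg A', norm_nonneg (B - B')]
  linarith

omit hM in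
/-- **`Y_x` IS LIPSCHITZ IN THE DATA**: both loops within `1/2` of `1` give `‖Y_x(V) − Y_x(V′)‖ ≤ 4(Σ_ν r_ν + L)·δ` ((21)/(26): `‖log X − log X′‖ ≤ 2‖X − X′‖`). [folklore] -/
theorem norm_Yx_sub_Yx_le [Nonempty m] (hVu : ∀ ν b, V ν b ∈ Matrix.unitaryGroup m ℂ) (hVu' : ∀ ν b, V' ν b ∈ Matrix.unitaryGroup m ℂ) {δ : ℝ}
    (hδ : ∀ ν b, ‖V ν b - V' ν b‖ ≤ δ) (L : ℕ) (z : Tor (fine N M)) (r : Fin d → ℕ) (hl : ‖loopHol N M V μ L z r - 1‖ ≤ 1 / 2) (hl' : ‖loopHol N M V' μ L z r - 1‖ ≤ 1 / 2) :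
    ‖Yx N M V μ L z r - Yx N M V' μ L z r‖ ≤ 4 * ((∑ ν, (r ν : ℝ)) + L) * δ := by
  rw [Yx, Yx, ← smul_sub, norm_smul, norm_neg, Complex.norm_I, one_mul]
  have h1 := norm_mlog_sub_mlog_le hl hl'
  have h2 := norm_loopHol_sub_loopHol_le N M μ hVu hVu' hδ L z r
  linarith

omit hM in
/-- **`Y` IS LIPSCHITZ IN THE DATA** (the block mean of the previous bound). [folklore] -/
theorem norm_Ybar_sub_Ybar_le (L : ℕ) [NeZero L] (z : Tor (fine N M)) {η : ℝ}
    (h : ∀ r : Fin d → Fin L, ‖Yx N M V μ L z (fun ν => (r ν : ℕ)) - Yx N M V' μ L z (fun ν => (r ν : ℕ))‖ ≤ η) :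
    ‖Ybar N M V μ L z - Ybar N M V' μ L z‖ ≤ η := by
  have hL : (0 : ℝ) < (L : ℝ) ^ d := pow_pos (by exact_mod_cast Nat.pos_of_ne_zero (NeZero.ne L)) d
  rw [Ybar, Ybar, ← Finset.sum_sub_distrib]
  calc ‖∑ r : Fin d → Fin L, ((((L : ℝ) ^ d)⁻¹) • Yx N M V μ L z (fun ν => (r ν : ℕ)) - (((L : ℝ) ^ d)⁻¹) • Yx N M V' μ L z (fun ν => (r ν : ℕ)))‖
      ≤ ∑ r : Fin d → Fin L, ‖(((L : ℝ) ^ d)⁻¹) • Yx N M V μ L z (fun ν => (r ν : ℕ)) - (((L : ℝ) ^ d)⁻¹) • Yx N M V' μ L z (fun ν => (r ν : ℕ))‖ := norm_sum_le _ _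
    _ ≤ ∑ _r : Fin d → Fin L, ((L : ℝ) ^ d)⁻¹ * η := Finset.sum_le_sum fun r _ => by
        rw [← smul_sub, norm_smul, norm_inv, norm_pow, Real.norm_natCast]; exact mul_le_mul_of_nonneg_left (h r) (by positivity)
    _ = η := by
        rw [Finset.sum_const, Finset.card_univ, Fintype.card_fun, Fintype.card_fin, Fintype.card_fin, nsmul_eq_mul]
        push_cast
        rw [← mul_assoc, mul_inv_cancel₀ hL.ne', one_mul]

end Data

/-! ## §2 `adLie` is real-linear; the coefficient shapes are Lipschitz in `(Y, Y_x)` -/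

section Adjoint

variable {n : Type} [Fintype n] [DecidableEq n] {ι : Type}

omit [DecidableEq n] in
/-- `adLie` is additive in `Y`: `ad_{Y − Y′} = ad_Y − ad_{Y′}`. [folklore] -/
theorem adLie_sub (c : ℝ) (e : ι → Matrix n n ℂ) (Y Y' : Matrix n n ℂ) : adLie c e (Y - Y') = adLie c e Y - adLie c e Y' := by
  ext k i
  simp only [adLie_apply, Matrix.sub_apply, sub_mul, mul_sub, ← map_sub]
  congr 1
  rw [← smul_sub]
  congr 1
  abel

variable [Fintype ι] [DecidableEq ι] {c : ℝ} (hc : 0 < c) (P : Submodule ℝ (Matrix n n ℂ)) (hPh : ∀ X ∈ P, X.IsHermitian) (e : ι → Matrix n n ℂ) (he : ∀ k, e k ∈ P)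
  (horth : ∀ k l, form c (e k) (e l) = if k = l then (1 : ℝ) else 0) (hcompl : ∀ X ∈ P, ∑ k, form c (e k) X • e k = X)
  (hPad : ∀ Y ∈ P, ∀ X ∈ P, Complex.I • (Y * X - X * Y) ∈ P)

include hc hPh he horth hcompl hPad in
/-- **`‖ad_Y − ad_{Y′}‖ ≤ 2‖Y − Y′‖`** (in the complexified component basis). [folklore] -/
theorem norm_cpx_adLie_sub_le {Y Y' : Matrix n n ℂ} (hY : Y ∈ P) (hY' : Y' ∈ P) : ‖cpxHom (adLie c e Y) - cpxHom (adLie c e Y')‖ ≤ 2 * ‖Y - Y'‖ := by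
  rw [← map_sub, ← adLie_sub]
  exact norm_cpx_adLie_le hc P hPh e he horth hcompl hPad (P.sub_mem hY hY')

variable [Nonempty ι]

include hc hPh he horth hcompl hPad in
/-- **`G₁` IS LIPSCHITZ IN `(Y, Y_x)`**: on the ball `‖·‖ ≤ y ≤ 1/8` of `P`, arguments within `η` give `‖G₁(Y,Y_x) − G₁(Y′,Y′_x)‖ ≤ 48η`. [folklore] -/
theorem norm_coeffG₁_sub_le {Y Yx Y' Yx' : Matrix n n ℂ} (hY : Y ∈ P) (hYx : Yx ∈ P) (hY' : Y' ∈ P) (hYx' : Yx' ∈ P) {y : ℝ} (hy0 : 0 ≤ y) (hy : y ≤ 1 / 8)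
    (hYn : ‖Y‖ ≤ y) (hYxn : ‖Yx‖ ≤ y) (hY'n : ‖Y'‖ ≤ y) (hYx'n : ‖Yx'‖ ≤ y) {η : ℝ} (hdY : ‖Y - Y'‖ ≤ η) (hdYx : ‖Yx - Yx'‖ ≤ η) :
    ‖coeffG₁ c e Y Yx - coeffG₁ c e Y' Yx'‖ ≤ 48 * η := by
  have hA : ∀ {Z : Matrix n n ℂ}, Z ∈ P → ‖Z‖ ≤ y → ‖-(Complex.I • cpxHom (adLie c e Z))‖ ≤ 2 * y := fun hZ hZn => by
    rw [norm_neg, norm_smul, Complex.norm_I, one_mul]; exact (norm_cpx_adLie_le hc P hPh e he horth hcompl hPad hZ).trans (by linarith)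
  have hD : ∀ {Z Z' : Matrix n n ℂ}, Z ∈ P → Z' ∈ P → ‖Z - Z'‖ ≤ η → ‖-(Complex.I • cpxHom (adLie c e Z)) - -(Complex.I • cpxHom (adLie c e Z'))‖ ≤ 2 * η :=
    fun hZ hZ' hd => by
      rw [← neg_sub', norm_neg, ← smul_sub, norm_smul, Complex.norm_I, one_mul]   -- `-a - -b = -(a - b)`
      exact (norm_cpx_adLie_sub_le hc P hPh e he horth hcompl hPad hZ hZ').trans (by linarith)
  have h := norm_coeff₁_sub_le (𝔸 := Matrix ι ι ℂ) (y := 2 * y) (δ := 2 * η) (by linarith) (by linarith) (hA hY hYn) (hA hYx hYxn) (hA hY' hY'n) (hA hYx' hYx'n)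
    (hD hY hY' hdY) (hD hYx hYx' hdYx)
  rw [coeffG₁, coeffG₁]
  linarith

include hc hPh he horth hcompl hPad in
/-- **`G₂` IS LIPSCHITZ IN `(Y, Y_x)`**: `≤ 48η` on the ball. [folklore] -/
theorem norm_coeffG₂_sub_le {Y Yx Y' Yx' : Matrix n n ℂ} (hY : Y ∈ P) (hYx : Yx ∈ P) (hY' : Y' ∈ P) (hYx' : Yx' ∈ P) {y : ℝ} (hy0 : 0 ≤ y) (hy : y ≤ 1 / 8)
    (hYn : ‖Y‖ ≤ y) (hYxn : ‖Yx‖ ≤ y) (hY'n : ‖Y'‖ ≤ y) (hYx'n : ‖Yx'‖ ≤ y) {η : ℝ} (hdY : ‖Y - Y'‖ ≤ η) (hdYx : ‖Yx - Yx'‖ ≤ η) :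
    ‖coeffG₂ c e Y Yx - coeffG₂ c e Y' Yx'‖ ≤ 48 * η := by
  have hA : ∀ {Z : Matrix n n ℂ}, Z ∈ P → ‖Z‖ ≤ y → ‖-(Complex.I • cpxHom (adLie c e Z))‖ ≤ 2 * y := fun hZ hZn => by
    rw [norm_neg, norm_smul, Complex.norm_I, one_mul]; exact (norm_cpx_adLie_le hc P hPh e he horth hcompl hPad hZ).trans (by linarith)
  have hB : ∀ {Z : Matrix n n ℂ}, Z ∈ P → ‖Z‖ ≤ y → ‖Complex.I • cpxHom (adLie c e Z)‖ ≤ 2 * y := fun hZ hZn => by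
    rw [norm_smul, Complex.norm_I, one_mul]; exact (norm_cpx_adLie_le hc P hPh e he horth hcompl hPad hZ).trans (by linarith)
  have hD : ∀ {Z Z' : Matrix n n ℂ}, Z ∈ P → Z' ∈ P → ‖Z - Z'‖ ≤ η → ‖-(Complex.I • cpxHom (adLie c e Z)) - -(Complex.I • cpxHom (adLie c e Z'))‖ ≤ 2 * η :=
    fun hZ hZ' hd => by
      rw [← neg_sub', norm_neg, ← smul_sub, norm_smul, Complex.norm_I, one_mul]
      exact (norm_cpx_adLie_sub_le hc P hPh e he horth hcompl hPad hZ hZ').trans (by linarith)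
  have hD' : ∀ {Z Z' : Matrix n n ℂ}, Z ∈ P → Z' ∈ P → ‖Z - Z'‖ ≤ η → ‖Complex.I • cpxHom (adLie c e Z) - Complex.I • cpxHom (adLie c e Z')‖ ≤ 2 * η :=
    fun hZ hZ' hd => by
      rw [← smul_sub, norm_smul, Complex.norm_I, one_mul]
      exact (norm_cpx_adLie_sub_le hc P hPh e he horth hcompl hPad hZ hZ').trans (by linarith)
  have h := norm_coeff₂_sub_le (𝔸 := Matrix ι ι ℂ) (y := 2 * y) (δ := 2 * η) (by linarith) (by linarith) (hA hY hYn) (hB hYx hYxn) (hA hY hYn) (hA hY' hY'n) (hB hYx' hYx'n)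
    (hA hY' hY'n) (hD hY hY' hdY) (hD' hYx hYx' hdYx) (hD hY hY' hdY)
  rw [coeffG₂, coeffG₂]
  linarith

include hc hPh he horth hcompl hPad in
/-- **`G₃` IS LIPSCHITZ IN `(Y, (Y_x)_x)`**: `≤ 48η` on the ball, for a probability weight on the block sites. [folklore] -/
theorem norm_coeffG₃_sub_le {κ : Type*} (s : Finset κ) {w : κ → ℝ} (hw0 : ∀ x ∈ s, 0 ≤ w x) (hw1 : ∑ x ∈ s, w x = 1) {Y Y' : Matrix n n ℂ} {Yx Yx' : κ → Matrix n n ℂ}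
    (hY : Y ∈ P) (hYx : ∀ x ∈ s, Yx x ∈ P) (hY' : Y' ∈ P) (hYx' : ∀ x ∈ s, Yx' x ∈ P) {y : ℝ} (hy0 : 0 ≤ y) (hy : y ≤ 1 / 8)
    (hYn : ‖Y‖ ≤ y) (hYxn : ∀ x ∈ s, ‖Yx x‖ ≤ y) (hY'n : ‖Y'‖ ≤ y) (hYx'n : ∀ x ∈ s, ‖Yx' x‖ ≤ y) {η : ℝ} (hdY : ‖Y - Y'‖ ≤ η) (hdYx : ∀ x ∈ s, ‖Yx x - Yx' x‖ ≤ η) :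
    ‖coeffG₃ s w c e Y Yx - coeffG₃ s w c e Y' Yx'‖ ≤ 48 * η := by
  have hA : ∀ {Z : Matrix n n ℂ}, Z ∈ P → ‖Z‖ ≤ y → ‖-(Complex.I • cpxHom (adLie c e Z))‖ ≤ 2 * y := fun hZ hZn => by
    rw [norm_neg, norm_smul, Complex.norm_I, one_mul]; exact (norm_cpx_adLie_le hc P hPh e he horth hcompl hPad hZ).trans (by linarith)
  have hB : ∀ {Z : Matrix n n ℂ}, Z ∈ P → ‖Z‖ ≤ y → ‖Complex.I • cpxHom (adLie c e Z)‖ ≤ 2 * y := fun hZ hZn => by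
    rw [norm_smul, Complex.norm_I, one_mul]; exact (norm_cpx_adLie_le hc P hPh e he horth hcompl hPad hZ).trans (by linarith)
  have hD : ∀ {Z Z' : Matrix n n ℂ}, Z ∈ P → Z' ∈ P → ‖Z - Z'‖ ≤ η → ‖-(Complex.I • cpxHom (adLie c e Z)) - -(Complex.I • cpxHom (adLie c e Z'))‖ ≤ 2 * η :=
    fun hZ hZ' hd => by
      rw [← neg_sub', norm_neg, ← smul_sub, norm_smul, Complex.norm_I, one_mul]
      exact (norm_cpx_adLie_sub_le hc P hPh e he horth hcompl hPad hZ hZ').trans (by linarith)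
  have hD' : ∀ {Z Z' : Matrix n n ℂ}, Z ∈ P → Z' ∈ P → ‖Z - Z'‖ ≤ η → ‖Complex.I • cpxHom (adLie c e Z) - Complex.I • cpxHom (adLie c e Z')‖ ≤ 2 * η :=
    fun hZ hZ' hd => by
      rw [← smul_sub, norm_smul, Complex.norm_I, one_mul]
      exact (norm_cpx_adLie_sub_le hc P hPh e he horth hcompl hPad hZ hZ').trans (by linarith)
  have h := norm_coeff₃_sub_le (𝔸 := Matrix ι ι ℂ) s hw0 hw1 (y := 2 * y) (δ := 2 * η) (by linarith) (by linarith)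
    (B := fun x => Complex.I • cpxHom (adLie c e (Yx x))) (B' := fun x => Complex.I • cpxHom (adLie c e (Yx' x)))
    (hA hY hYn) (hB hY hYn) (fun x hx => hB (hYx x hx) (hYxn x hx)) (hA hY' hY'n) (hB hY' hY'n) (fun x hx => hB (hYx' x hx) (hYx'n x hx))
    (hD hY hY' hdY) (hD' hY hY' hdY) (fun x hx => hD' (hYx x hx) (hYx' x hx) (hdYx x hx))
  rw [coeffG₃, coeffG₃]
  linarith

end Adjoint

/-! ## §3 Along the tower: the `δG` letter from closeness of the fundamental fields -/

section Tower

variable (L : ℕ) [NeZero L] (M : Fin d → ℕ) [hM : ∀ μ, NeZero (M μ)] {n : Type} [Fintype n] [DecidableEq n] [Nonempty n] {ι : Type} [Fintype ι] [DecidableEq ι] [Nonempty ι]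
  {c : ℝ} (hc : 0 < c) (P : Submodule ℝ (Matrix n n ℂ)) (hPh : ∀ X ∈ P, X.IsHermitian) (e : ι → Matrix n n ℂ) (he : ∀ k, e k ∈ P)
  (horth : ∀ k l, form c (e k) (e l) = if k = l then (1 : ℝ) else 0) (hcompl : ∀ X ∈ P, ∑ k, form c (e k) X • e k = X)
  (hPad : ∀ Y ∈ P, ∀ X ∈ P, Complex.I • (Y * X - X * Y) ∈ P)
  {U U' : (i : ℕ) → Fin d → (idx L M i → Matrix n n ℂ)}

omit hM in
/-- **THE LOOP DATA OF TWO CLOSE TOWERS ARE CLOSE**: at step `i`, unitary `U, U′` with plaquette letter `p` (`d·L²·p ≤ 1/4`) and level-`(i+1)` fields within `cU` bondwise give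
`‖Y_x(U) − Y_x(U′)‖, ‖Y(U) − Y(U′)‖ ≤ 4(d+1)L·cU`. [folklore] -/
theorem loop_data_sub_le (hUu : ∀ i ν b, U i ν b ∈ Matrix.unitaryGroup n ℂ) (hUu' : ∀ i ν b, U' i ν b ∈ Matrix.unitaryGroup n ℂ) {p : ℝ} (hp0 : 0 ≤ p) (i : ℕ)
    (hp : ∀ (x : Tor (fine (L * lev L i) M)) (ν μ : Fin d),
      ‖U (i + 1) ν (x, μ) * U (i + 1) μ (x + unitVec (fine (L * lev L i) M) ν, μ) - U (i + 1) μ (x, μ) * U (i + 1) ν (x + unitVec (fine (L * lev L i) M) μ, μ)‖ ≤ p)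
    (hp' : ∀ (x : Tor (fine (L * lev L i) M)) (ν μ : Fin d),
      ‖U' (i + 1) ν (x, μ) * U' (i + 1) μ (x + unitVec (fine (L * lev L i) M) ν, μ) - U' (i + 1) μ (x, μ) * U' (i + 1) ν (x + unitVec (fine (L * lev L i) M) μ, μ)‖ ≤ p)
    (hsmall : d * (L : ℝ) ^ 2 * p ≤ 1 / 4) {cU : ℝ} (hcU : ∀ ν b, ‖U (i + 1) ν b - U' (i + 1) ν b‖ ≤ cU) (x : Tor (fine (lev L i) M)) (μ : Fin d) :
    (∀ r : Fin d → Fin L, ‖YxT L M U i x μ r - YxT L M U' i x μ r‖ ≤ 4 * ((d + 1) * L) * cU) ∧ ‖YbarT L M U i x μ - YbarT L M U' i x μ‖ ≤ 4 * ((d + 1) * L) * cU := by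
  have hcU0 : 0 ≤ cU := (norm_nonneg _).trans (hcU μ (cpt (lev L i) L M x, μ))
  have hYx : ∀ r : Fin d → Fin L, ‖YxT L M U i x μ r - YxT L M U' i x μ r‖ ≤ 4 * ((d + 1) * L) * cU := by
    intro r
    have hl := norm_loopHol_sub_one_le_of_digits (L * lev L i) M μ L (V := U (i + 1)) (hUu (i + 1)) hp0 (fun y ν => hp y ν μ) (cpt (lev L i) L M x) r
    have hl' := norm_loopHol_sub_one_le_of_digits (L * lev L i) M μ L (V := U' (i + 1)) (hUu' (i + 1)) hp0 (fun y ν => hp' y ν μ) (cpt (lev L i) L M x) r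
    have h := norm_Yx_sub_Yx_le (L * lev L i) M μ (hUu (i + 1)) (hUu' (i + 1)) hcU L (cpt (lev L i) L M x) (fun ν => (r ν : ℕ)) (hl.trans (by linarith))
      (hl'.trans (by linarith))
    have hsum : (∑ ν, ((r ν : ℕ) : ℝ)) ≤ d * (L : ℝ) := by
      calc (∑ ν, ((r ν : ℕ) : ℝ)) ≤ ∑ _ν : Fin d, (L : ℝ) := Finset.sum_le_sum fun ν _ => by exact_mod_cast (r ν).2.le
        _ = d * (L : ℝ) := by rw [Finset.sum_const, Finset.card_univ, Fintype.card_fin, nsmul_eq_mul]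
    refine h.trans ?_
    have : 4 * ((∑ ν, ((r ν : ℕ) : ℝ)) + L) * cU ≤ 4 * (d * (L : ℝ) + L) * cU := by gcongr
    refine this.trans (le_of_eq ?_)
    ring
  exact ⟨hYx, norm_Ybar_sub_Ybar_le (L * lev L i) M μ L (cpt (lev L i) L M x) hYx⟩

include hc hPh he horth hcompl hPad in
omit hM in
/-- **THE `δG` LETTER OF `G₁` FROM CLOSENESS OF THE FUNDAMENTAL FIELDS**: `‖G₁(U) i x μ r − G₁(U′) i x μ r‖ ≤ 192·(d+1)·L·cU` under unitarity, plaquette letters with `d·L²·p ≤ 1/16`,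
the `Y_x` in `P`, and `‖U (i+1) − U′ (i+1)‖ ≤ cU` bondwise. [folklore] -/
theorem norm_remCoeffOf_G₁_sub_le (hUu : ∀ i ν b, U i ν b ∈ Matrix.unitaryGroup n ℂ) (hUu' : ∀ i ν b, U' i ν b ∈ Matrix.unitaryGroup n ℂ) {p : ℝ} (hp0 : 0 ≤ p) (i : ℕ)
    (hp : ∀ (x : Tor (fine (L * lev L i) M)) (ν μ : Fin d),
      ‖U (i + 1) ν (x, μ) * U (i + 1) μ (x + unitVec (fine (L * lev L i) M) ν, μ) - U (i + 1) μ (x, μ) * U (i + 1) ν (x + unitVec (fine (L * lev L i) M) μ, μ)‖ ≤ p)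
    (hp' : ∀ (x : Tor (fine (L * lev L i) M)) (ν μ : Fin d),
      ‖U' (i + 1) ν (x, μ) * U' (i + 1) μ (x + unitVec (fine (L * lev L i) M) ν, μ) - U' (i + 1) μ (x, μ) * U' (i + 1) ν (x + unitVec (fine (L * lev L i) M) μ, μ)‖ ≤ p)
    (hsmall : d * (L : ℝ) ^ 2 * p ≤ 1 / 16) (hYP : ∀ x μ r, YxT L M U i x μ r ∈ P) (hYP' : ∀ x μ r, YxT L M U' i x μ r ∈ P) {cU : ℝ}
    (hcU : ∀ ν b, ‖U (i + 1) ν b - U' (i + 1) ν b‖ ≤ cU) (W W' : (i : ℕ) → Fin d → (idx L M i → Matrix ι ι ℂ)) (x : Tor (fine (lev L i) M)) (μ : Fin d) (r : Fin d → Fin L) :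
    ‖(remCoeffOf L M U c e W).G₁ i x μ r - (remCoeffOf L M U' c e W').G₁ i x μ r‖ ≤ 192 * ((d + 1) * L) * cU := by
  have hs4 : d * (L : ℝ) ^ 2 * p ≤ 1 / 4 := hsmall.trans (by norm_num)
  have hl := Yx_letters L M hUu hp0 i hp hs4 x μ r
  have hl' := Yx_letters L M hUu' hp0 i hp' hs4 x μ r
  have hb := Ybar_letters L M hUu hp0 i hp hs4 x μ
  have hb' := Ybar_letters L M hUu' hp0 i hp' hs4 x μ
  have hYb : YbarT L M U i x μ ∈ P := P.sum_mem fun r' _ => P.smul_mem _ (hYP x μ r')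
  have hYb' : YbarT L M U' i x μ ∈ P := P.sum_mem fun r' _ => P.smul_mem _ (hYP' x μ r')
  have hd := loop_data_sub_le L M hUu hUu' hp0 i hp hp' hs4 hcU x μ
  have h := norm_coeffG₁_sub_le hc P hPh e he horth hcompl hPad hYb (hYP x μ r) hYb' (hYP' x μ r) (y := 2 * (d * (L : ℝ) ^ 2 * p)) (by positivity) (by linarith)
    hb.1 hl.1 hb'.1 hl'.1 hd.2 (hd.1 r)
  show ‖coeffG₁ c e (YbarT L M U i x μ) (YxT L M U i x μ r) - coeffG₁ c e (YbarT L M U' i x μ) (YxT L M U' i x μ r)‖ ≤ _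
  linarith

include hc hPh he horth hcompl hPad in
omit hM in
/-- the `δG` letter of `G₂`: `≤ 192·(d+1)·L·cU`. [folklore] -/
theorem norm_remCoeffOf_G₂_sub_le (hUu : ∀ i ν b, U i ν b ∈ Matrix.unitaryGroup n ℂ) (hUu' : ∀ i ν b, U' i ν b ∈ Matrix.unitaryGroup n ℂ) {p : ℝ} (hp0 : 0 ≤ p) (i : ℕ)
    (hp : ∀ (x : Tor (fine (L * lev L i) M)) (ν μ : Fin d),
      ‖U (i + 1) ν (x, μ) * U (i + 1) μ (x + unitVec (fine (L * lev L i) M) ν, μ) - U (i + 1) μ (x, μ) * U (i + 1) ν (x + unitVec (fine (L * lev L i) M) μ, μ)‖ ≤ p)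
    (hp' : ∀ (x : Tor (fine (L * lev L i) M)) (ν μ : Fin d),
      ‖U' (i + 1) ν (x, μ) * U' (i + 1) μ (x + unitVec (fine (L * lev L i) M) ν, μ) - U' (i + 1) μ (x, μ) * U' (i + 1) ν (x + unitVec (fine (L * lev L i) M) μ, μ)‖ ≤ p)
    (hsmall : d * (L : ℝ) ^ 2 * p ≤ 1 / 16) (hYP : ∀ x μ r, YxT L M U i x μ r ∈ P) (hYP' : ∀ x μ r, YxT L M U' i x μ r ∈ P) {cU : ℝ}
    (hcU : ∀ ν b, ‖U (i + 1) ν b - U' (i + 1) ν b‖ ≤ cU) (W W' : (i : ℕ) → Fin d → (idx L M i → Matrix ι ι ℂ)) (x : Tor (fine (lev L i) M)) (μ : Fin d) (r : Fin d → Fin L) :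
    ‖(remCoeffOf L M U c e W).G₂ i x μ r - (remCoeffOf L M U' c e W').G₂ i x μ r‖ ≤ 192 * ((d + 1) * L) * cU := by
  have hs4 : d * (L : ℝ) ^ 2 * p ≤ 1 / 4 := hsmall.trans (by norm_num)
  have hl := Yx_letters L M hUu hp0 i hp hs4 x μ r
  have hl' := Yx_letters L M hUu' hp0 i hp' hs4 x μ r
  have hb := Ybar_letters L M hUu hp0 i hp hs4 x μ
  have hb' := Ybar_letters L M hUu' hp0 i hp' hs4 x μ
  have hYb : YbarT L M U i x μ ∈ P := P.sum_mem fun r' _ => P.smul_mem _ (hYP x μ r')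
  have hYb' : YbarT L M U' i x μ ∈ P := P.sum_mem fun r' _ => P.smul_mem _ (hYP' x μ r')
  have hd := loop_data_sub_le L M hUu hUu' hp0 i hp hp' hs4 hcU x μ
  have h := norm_coeffG₂_sub_le hc P hPh e he horth hcompl hPad hYb (hYP x μ r) hYb' (hYP' x μ r) (y := 2 * (d * (L : ℝ) ^ 2 * p)) (by positivity) (by linarith)
    hb.1 hl.1 hb'.1 hl'.1 hd.2 (hd.1 r)
  show ‖coeffG₂ c e (YbarT L M U i x μ) (YxT L M U i x μ r) - coeffG₂ c e (YbarT L M U' i x μ) (YxT L M U' i x μ r)‖ ≤ _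
  linarith

include hc hPh he horth hcompl hPad in
omit hM in
/-- the `δG` letter of `G₃`: `≤ 192·(d+1)·L·cU`. [folklore] -/
theorem norm_remCoeffOf_G₃_sub_le (hUu : ∀ i ν b, U i ν b ∈ Matrix.unitaryGroup n ℂ) (hUu' : ∀ i ν b, U' i ν b ∈ Matrix.unitaryGroup n ℂ) {p : ℝ} (hp0 : 0 ≤ p) (i : ℕ)
    (hp : ∀ (x : Tor (fine (L * lev L i) M)) (ν μ : Fin d),
      ‖U (i + 1) ν (x, μ) * U (i + 1) μ (x + unitVec (fine (L * lev L i) M) ν, μ) - U (i + 1) μ (x, μ) * U (i + 1) ν (x + unitVec (fine (L * lev L i) M) μ, μ)‖ ≤ p)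
    (hp' : ∀ (x : Tor (fine (L * lev L i) M)) (ν μ : Fin d),
      ‖U' (i + 1) ν (x, μ) * U' (i + 1) μ (x + unitVec (fine (L * lev L i) M) ν, μ) - U' (i + 1) μ (x, μ) * U' (i + 1) ν (x + unitVec (fine (L * lev L i) M) μ, μ)‖ ≤ p)
    (hsmall : d * (L : ℝ) ^ 2 * p ≤ 1 / 16) (hYP : ∀ x μ r, YxT L M U i x μ r ∈ P) (hYP' : ∀ x μ r, YxT L M U' i x μ r ∈ P) {cU : ℝ}
    (hcU : ∀ ν b, ‖U (i + 1) ν b - U' (i + 1) ν b‖ ≤ cU) (W W' : (i : ℕ) → Fin d → (idx L M i → Matrix ι ι ℂ)) (x : Tor (fine (lev L i) M)) (μ : Fin d) :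
    ‖(remCoeffOf L M U c e W).G₃ i x μ - (remCoeffOf L M U' c e W').G₃ i x μ‖ ≤ 192 * ((d + 1) * L) * cU := by
  have hs4 : d * (L : ℝ) ^ 2 * p ≤ 1 / 4 := hsmall.trans (by norm_num)
  have hl := fun r => Yx_letters L M hUu hp0 i hp hs4 x μ r
  have hl' := fun r => Yx_letters L M hUu' hp0 i hp' hs4 x μ r
  have hb := Ybar_letters L M hUu hp0 i hp hs4 x μ
  have hb' := Ybar_letters L M hUu' hp0 i hp' hs4 x μ
  have hYb : YbarT L M U i x μ ∈ P := P.sum_mem fun r' _ => P.smul_mem _ (hYP x μ r')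
  have hYb' : YbarT L M U' i x μ ∈ P := P.sum_mem fun r' _ => P.smul_mem _ (hYP' x μ r')
  have hd := loop_data_sub_le L M hUu hUu' hp0 i hp hp' hs4 hcU x μ
  have h := norm_coeffG₃_sub_le hc P hPh e he horth hcompl hPad Finset.univ (w := fun _ : Fin d → Fin L => ((L : ℝ) ^ d)⁻¹) (fun _ _ => by positivity)
    (sum_blockWeight L) (Yx := fun r => YxT L M U i x μ r) (Yx' := fun r => YxT L M U' i x μ r) hYb (fun r _ => hYP x μ r) hYb' (fun r _ => hYP' x μ r)
    (y := 2 * (d * (L : ℝ) ^ 2 * p)) (by positivity) (by linarith) hb.1 (fun r _ => (hl r).1) hb'.1 (fun r _ => (hl' r).1) hd.2 (fun r _ => hd.1 r)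
  show ‖coeffG₃ Finset.univ (fun _ : Fin d → Fin L => ((L : ℝ) ^ d)⁻¹) c e (YbarT L M U i x μ) (fun r => YxT L M U i x μ r)
      - coeffG₃ Finset.univ (fun _ : Fin d → Fin L => ((L : ℝ) ^ d)⁻¹) c e (YbarT L M U' i x μ) (fun r => YxT L M U' i x μ r)‖ ≤ _
  linarith

end Tower

end Summit.QuantumFields.BalabanUV.T4Continuum.NE2.OneStepRemainderLoopLipschitz

end
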